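/-
Copyright: cell `pub-balaban-gaps` (G2), seat ne6 (row NE7b), `prover-pub-balaban-gaps-ne6-g19-0`. Project licence.
-/
import Summits.QuantumFields.BalabanUV.T4Continuum.Spine.NE7b.CompactFibrePlaquetteMassSUNQuasiMonotone

/-!
# THE `LocCondStability` LETTER OF THE `SU(N)` COMPACT-FIBRE REFERENCE STATE WITH NO ADDITIVE CONSTANT: for EVERY `N ≥ 2`, UNCONDITIONALLY on the
# strong-coupling window `0 ≤ β ≤ (N²−1)∕(2N)`, `∫ e^{δβs}e^{−βs} dHaar_{SU(N)} ≤ (1−δ)^{−(N²−1)∕2}·∫ e^{−βs} dHaar_{SU(N)}` (`s = Re tr(1−V)`, `0 ≤ δ < 1`) and the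
# REGION letter is exactly print's `#B·½·dim SU(N)·log(1−δ)⁻¹`; at ALL couplings the constant-free letter is EQUIVALENT to the equipartition inequality
# `β⟨s⟩_β ≤ (N²−1)∕2` (hence implied by the sharp window doubling) (row NE7b, node U5c; MODEL, [folklore]; census V53 — junction of V52 with V38)

Cell `pub-balaban-gaps` (G2 spine census) for the `pub-balaban` T⁴ crux NE7b (`T4WeightBudget.RelWeightBound`; NOT PRINTED, NOT PROVED).  Crux-route work under `Spine/NE7b/`;
imports this lineage's V52 `CompactFibrePlaquetteMassSUNQuasiMonotone` (monotonicity of the scaled one-plaquette mass: unconditional on the strong-coupling window, `↔` the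
equipartition inequality on `(0,∞)`, `⟸` the sharp doubling) — in particular on the free-energy window `{β ≥ 0 ∣ −log Z_N(β) ≤ (N²−1)∕2}` ⊇ `[0,(N²−1)∕(2N)]` — and through it V38
`CompactFibreHalvedActionSUN` (`pi_halvedAction_moment_le`: the product form over a bond set), V50 (`freeEnergy_SUN_monotoneOn`), V49, V48, V40b-Haar; Mathlib only otherwise; no `def`, zero `sorry`, nothing of Bałaban's asserted.  V38's `exists_lcsLetter_compactFibre` (letter `#B·(c + ((N²−1)∕2)·log(1−δ)⁻¹)`,
`c = log D ≥ 0`) and `CompactFibreHalvedActionSU2Sharp` (`c = 0` for `N = 2`) are NOT restated: this file says WHEN `c = 0` for every `N`.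

THE LOCATED QUESTION (census V53).  V38 priced the sacrificed fraction `δ` of a region's Wilson action in the compact-fibre REFERENCE state at `½·dim SU(N)·log(1−δ)⁻¹ + c` per
plaquette, `c = log D` with `D ≥ 1` the window-doubling constant — print's letter ([Balaban1989LargeFieldI] (0.3)–(0.5); Dimock III (184): the halved Gaussian's `2^{n∕2}`,
i.e. `c = 0`) carries NO additive constant.  Gen 16∕17 removed `c` for `N = 2` (V40b's `D = 1`).  QUESTION: for which `N` and which couplings is `c = 0`, unconditionally?
ANSWER ([folklore]; V52's monotonicity read through the identity `∫ e^{δβs}e^{−βs} = Z_N((1−δ)β)`):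
* §1 **`halvedAction_eq_plaquetteMass`** (`∫ e^{δβs}e^{−βs} dHaar = Z_N((1−δ)β)`); **`halvedAction_sharp_of_monotoneOn`** — if `β ↦ (√β)^{N²−1}Z_N(β)` is non-decreasing on a
  set containing `(1−δ)β` and `β` (`β > 0`), then `∫ e^{δβs}e^{−βs} ≤ (√(1−δ))⁻¹^{N²−1}·∫ e^{−βs}` — the letter with `c = 0` at that coupling.
* §2 EVERY `N`, UNCONDITIONAL, ON THE FREE-ENERGY WINDOW `W_N = {β ≥ 0 ∣ −log Z_N(β) ≤ (N²−1)∕2}` (V52 §4: an interval ⊇ `[0, (N²−1)∕(2N)]` on which the scaled mass is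
  non-decreasing): **`halvedAction_sharp_of_freeEnergy_le`** ∕ **`halvedAction_sharp_strongCoupling`** — `c = 0` for ALL `β ∈ W_N` (so ALL `0 ≤ β ≤ (N²−1)∕(2N)`, `N ≥ 2`), ALL
  `0 ≤ δ < 1`; `equipartition_le_of_freeEnergy_le` (`β⟨s⟩_β ≤ (N²−1)∕2` on `W_N`), `plaquetteMass_ratio_le_of_freeEnergy_le` (`Z_N(νβ) ≤ ν^{−(N²−1)∕2}Z_N(β)`, `0 < ν ≤ 1`, on `W_N` — V49's limit ratio as a
  finite-coupling bound); the REGION forms **`lcsLetter_SUN_sharp_of_freeEnergy_le`** ∕ **`lcsLetter_SUN_sharp_strongCoupling`**: on the product Haar of `B → SU(N)`,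
  `∫ e^{δβS}e^{−βS} dκ ≤ exp(#B·((N²−1)∕2)·log(1−δ)⁻¹)·∫ e^{−βS} dκ` — V38's `exists_lcsLetter_compactFibre` with `c = 0` there.
* §3 EVERY `N`, ALL COUPLINGS — THE CRITERION: **`halvedAction_sharp_iff_equipartition_le`** — (`c = 0` at every `β > 0`, every `0 ≤ δ < 1`) `↔` (`β·⟨Re tr(1−V)⟩_β ≤ (N²−1)∕2`
  at every `β > 0`) (V52's `scaled_plaquetteMass_SUN_monotoneOn_iff_equipartition_le`; ⇒: `δ = 1 − β₁∕β₂`); **`halvedAction_sharp_of_doubling_one`** ∕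
  **`lcsLetter_SUN_sharp_of_doubling_one`** — the sharp trace-window doubling gives `c = 0` at every `β ≥ 0` and the region letter `#B·((N²−1)∕2)·log(1−δ)⁻¹`, every `N`.
* §4 `N = 2` (`example`s, nothing restated): `CompactFibreHalvedActionSU2Sharp.halvedAction_moment_le_sharp` ∕ `lcsLetter_SU2_sharp` reached through §3 from V40b-Haar.

HONEST REMARKS.  (i) MODEL ∕ [folklore]: the compact-fibre carrier's product REFERENCE state (independent `SU(N)` plaquette variables under Haar), NOT the interacting measure and
NOT an inhabitant of `LocalConditionalStability.LocCondStability` for Bałaban's tower ((A1c), NC-NE7b-α UNRULED).  (ii) Beyond the free-energy window `c = 0` is NOT proved for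
`N ≥ 3`: by §3 it is EQUIVALENT to the equipartition inequality (V52's named residual; by-value screen consistent for `N = 3`); V38's `c = log D` stands there.  (iii) Nothing on
the windows `η(g_k)` ∕ exponents of print.  BY-NAME EFFECT ON THE WALL: NONE.  NE7b NOT PRINTED ∕ NOT PROVED; spine PROVED 0∕9; rung (B)+1 on ONE finite T⁴ — NOT infinite
volume, NOT the mass gap, NOT Clay.
HONEST DEPENDENCY: continuum YM on T⁴ ⇐ BetaPertH ∧ nine spine estimates (0/9 proved); BetaPertH ⇐ (D1) ∧ (D4) ∧ CAP+tail;
G-an2-4 gates asym, D1 and NE2/3/4.  This file changes none of it.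
-/

set_option autoImplicit false

noncomputable section

open MeasureTheory Real Set Filter Topology
open scoped Matrix.Norms.Frobenius
open Literature.MathematicalPhysics.QuantumFieldTheory (haarProbability)
open Summit.QuantumFields.BalabanUV.T4Continuum.NE7b.CompactFibreHalvedActionSUN (pi_halvedAction_moment_le)
open Summit.QuantumFields.BalabanUV.T4Continuum.NE7b.CompactFibreMeanActionSUNMonotone (plaquetteMass_SUN_pos_real freeEnergy_SUN_monotoneOn)
open Summit.QuantumFields.BalabanUV.T4Continuum.NE7b.CompactFibreMeanActionSUNLimit (mul_meanAction_le_freeEnergy)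
open Summit.QuantumFields.BalabanUV.T4Continuum.NE7b.CompactFibreWindowSU2DoublingHaar (haarReal_traceWindow_doubling_one)
open Summit.QuantumFields.BalabanUV.T4Continuum.NE7b.CompactFibrePlaquetteMassSUNQuasiMonotone

namespace Summit.QuantumFields.BalabanUV.T4Continuum.NE7b.CompactFibreHalvedActionSUNSharp

variable {N : ℕ}

/-! ## §1 The halved-action moment is the one-plaquette mass at the reduced coupling; monotonicity gives the constant-free letter -/

/-- `∫ e^{δβs}·e^{−βs} dHaar_{SU(N)} = Z_N((1−δ)β)` (`s = Re tr(1−V)`): the tilted moment of the sacrificed fraction is the one-plaquette mass at the reduced coupling. [folklore] -/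
theorem halvedAction_eq_plaquetteMass (β δ : ℝ) :
    ∫ V, Real.exp (δ * β * (Matrix.trace (1 - (V : Matrix (Fin N) (Fin N) ℂ))).re) * Real.exp (-(β * (Matrix.trace (1 - (V : Matrix (Fin N) (Fin N) ℂ))).re)) ∂(haarProbability (Matrix.specialUnitaryGroup (Fin N) ℂ))
      = ∫ V, Real.exp (-(((1 - δ) * β) * (Matrix.trace (1 - (V : Matrix (Fin N) (Fin N) ℂ))).re)) ∂(haarProbability (Matrix.specialUnitaryGroup (Fin N) ℂ)) := by
  refine integral_congr_ae (ae_of_all _ fun V => ?_)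
  dsimp only
  rw [← Real.exp_add]; ring_nf

/-- For `β > 0`, `δ < 1`: `(√(1−δ))⁻¹^d = (√β)^d ∕ (√((1−δ)β))^d`. -/
theorem sqrt_one_sub_inv_pow_eq {β δ : ℝ} (hβ : 0 < β) (hδ1 : δ < 1) (d : ℕ) :
    (Real.sqrt (1 - δ))⁻¹ ^ d = Real.sqrt β ^ d / Real.sqrt ((1 - δ) * β) ^ d := by
  have h1δ : 0 < 1 - δ := by linarith
  have hs1 : Real.sqrt (1 - δ) ≠ 0 := (Real.sqrt_pos.2 h1δ).ne'
  have hsβ : Real.sqrt β ≠ 0 := (Real.sqrt_pos.2 hβ).ne'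
  rw [Real.sqrt_mul h1δ.le, ← div_pow]
  congr 1
  field_simp

/-- **MONOTONICITY GIVES THE CONSTANT-FREE LETTER.**  If `β ↦ (√β)^{N²−1}·Z_N(β)` is non-decreasing on a set `S` containing `(1−δ)β` and `β` (`β > 0`, `0 ≤ δ < 1`), then
`∫ e^{δβs}e^{−βs} dHaar_{SU(N)} ≤ (√(1−δ))⁻¹^{N²−1}·∫ e^{−βs} dHaar_{SU(N)}` — the `LocCondStability` letter `½·(N²−1)·log(1−δ)⁻¹` with NO additive constant. [folklore] -/
theorem halvedAction_sharp_of_monotoneOn {S : Set ℝ}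
    (hmono : MonotoneOn (fun β : ℝ => Real.sqrt β ^ (N ^ 2 - 1) * ∫ V, Real.exp (-(β * (Matrix.trace (1 - (V : Matrix (Fin N) (Fin N) ℂ))).re)) ∂(haarProbability (Matrix.specialUnitaryGroup (Fin N) ℂ))) S)
    {β δ : ℝ} (hβ : 0 < β) (hδ0 : 0 ≤ δ) (hδ1 : δ < 1) (h1 : (1 - δ) * β ∈ S) (h2 : β ∈ S) :
    ∫ V, Real.exp (δ * β * (Matrix.trace (1 - (V : Matrix (Fin N) (Fin N) ℂ))).re) * Real.exp (-(β * (Matrix.trace (1 - (V : Matrix (Fin N) (Fin N) ℂ))).re)) ∂(haarProbability (Matrix.specialUnitaryGroup (Fin N) ℂ))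
      ≤ (Real.sqrt (1 - δ))⁻¹ ^ (N ^ 2 - 1) * ∫ V, Real.exp (-(β * (Matrix.trace (1 - (V : Matrix (Fin N) (Fin N) ℂ))).re)) ∂(haarProbability (Matrix.specialUnitaryGroup (Fin N) ℂ)) := by
  have h1δ : 0 < 1 - δ := by linarith
  have hle : (1 - δ) * β ≤ β := by nlinarith
  have hm := hmono h1 h2 hle
  simp only at hm
  have hpos : 0 < Real.sqrt ((1 - δ) * β) ^ (N ^ 2 - 1) := pow_pos (Real.sqrt_pos.2 (mul_pos h1δ hβ)) _
  rw [halvedAction_eq_plaquetteMass, sqrt_one_sub_inv_pow_eq hβ hδ1, div_mul_eq_mul_div, le_div_iff₀ hpos, mul_comm]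
  exact hm

/-! ## §2 Every `N`, unconditionally: the constant-free letter on the FREE-ENERGY WINDOW `{β ≥ 0 ∣ −log Z_N(β) ≤ (N²−1)∕2}` ⊇ `[0, (N²−1)∕(2N)]`, one plaquette and a region -/

/-- **THE CONSTANT-FREE HALVED-ACTION LETTER ON THE FREE-ENERGY WINDOW, EVERY `N`, UNCONDITIONALLY**: if `β ≥ 0`, `−log Z_N(β) ≤ (N²−1)∕2` and `0 ≤ δ < 1`, then
`∫ e^{δβ·Re tr(1−V)}·e^{−β·Re tr(1−V)} dHaar_{SU(N)}(V) ≤ (√(1−δ))⁻¹^{N²−1}·∫ e^{−β·Re tr(1−V)} dHaar_{SU(N)}(V)` — V38's `exists_halvedAction_moment_le` with `D = 1` there. [folklore] -/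
theorem halvedAction_sharp_of_freeEnergy_le {β δ : ℝ} (hβ : 0 ≤ β) (hF : -Real.log (∫ V, Real.exp (-(β * (Matrix.trace (1 - (V : Matrix (Fin N) (Fin N) ℂ))).re)) ∂(haarProbability (Matrix.specialUnitaryGroup (Fin N) ℂ))) ≤ ((N ^ 2 - 1 : ℕ) : ℝ) / 2) (hδ0 : 0 ≤ δ) (hδ1 : δ < 1) :
    ∫ V, Real.exp (δ * β * (Matrix.trace (1 - (V : Matrix (Fin N) (Fin N) ℂ))).re) * Real.exp (-(β * (Matrix.trace (1 - (V : Matrix (Fin N) (Fin N) ℂ))).re)) ∂(haarProbability (Matrix.specialUnitaryGroup (Fin N) ℂ))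
      ≤ (Real.sqrt (1 - δ))⁻¹ ^ (N ^ 2 - 1) * ∫ V, Real.exp (-(β * (Matrix.trace (1 - (V : Matrix (Fin N) (Fin N) ℂ))).re)) ∂(haarProbability (Matrix.specialUnitaryGroup (Fin N) ℂ)) := by
  have h1δ : 0 < 1 - δ := by linarith
  rcases hβ.eq_or_lt with hβ0 | hβpos
  · -- `β = 0`: both integrals are `Z_N(0)`, and the factor is `≥ 1`
    subst hβ0
    have hK1 : (1 : ℝ) ≤ (Real.sqrt (1 - δ))⁻¹ ^ (N ^ 2 - 1) := by
      refine one_le_pow₀ ?_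
      rw [one_le_inv₀ (Real.sqrt_pos.2 h1δ)]
      exact Real.sqrt_le_one.2 (by linarith)
    rw [halvedAction_eq_plaquetteMass, mul_zero]
    exact le_mul_of_one_le_left (plaquetteMass_SUN_pos_real (N := N) 0).le hK1
  · have hle : (1 - δ) * β ≤ β := by nlinarith
    have h1 : 0 < (1 - δ) * β := mul_pos h1δ hβpos
    have hF1 : -Real.log (∫ V, Real.exp (-((1 - δ) * β * (Matrix.trace (1 - (V : Matrix (Fin N) (Fin N) ℂ))).re)) ∂(haarProbability (Matrix.specialUnitaryGroup (Fin N) ℂ))) ≤ ((N ^ 2 - 1 : ℕ) : ℝ) / 2 :=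
      (freeEnergy_SUN_monotoneOn (N := N) (show (0 : ℝ) ≤ (1 - δ) * β from h1.le) (show (0 : ℝ) ≤ β from hβ) hle).trans hF
    exact halvedAction_sharp_of_monotoneOn scaled_plaquetteMass_SUN_monotoneOn_freeEnergyWindow_pos hβpos hδ0 hδ1 ⟨h1, hF1⟩ ⟨hβpos, hF⟩

/-- **THE CONSTANT-FREE HALVED-ACTION LETTER AT STRONG COUPLING, EVERY `N ≥ 2`, UNCONDITIONALLY**: for `0 ≤ β ≤ (N²−1)∕(2N)` and `0 ≤ δ < 1`,
`∫ e^{δβ·Re tr(1−V)}·e^{−β·Re tr(1−V)} dHaar_{SU(N)}(V) ≤ (√(1−δ))⁻¹^{N²−1}·∫ e^{−β·Re tr(1−V)} dHaar_{SU(N)}(V)` (`N = 3`: all `β ≤ 4∕3`). [folklore] -/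
theorem halvedAction_sharp_strongCoupling (hN : 2 ≤ N) {β δ : ℝ} (hβ : 0 ≤ β) (hβb : β ≤ ((N ^ 2 - 1 : ℕ) : ℝ) / (2 * N)) (hδ0 : 0 ≤ δ) (hδ1 : δ < 1) :
    ∫ V, Real.exp (δ * β * (Matrix.trace (1 - (V : Matrix (Fin N) (Fin N) ℂ))).re) * Real.exp (-(β * (Matrix.trace (1 - (V : Matrix (Fin N) (Fin N) ℂ))).re)) ∂(haarProbability (Matrix.specialUnitaryGroup (Fin N) ℂ))
      ≤ (Real.sqrt (1 - δ))⁻¹ ^ (N ^ 2 - 1) * ∫ V, Real.exp (-(β * (Matrix.trace (1 - (V : Matrix (Fin N) (Fin N) ℂ))).re)) ∂(haarProbability (Matrix.specialUnitaryGroup (Fin N) ℂ)) :=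
  halvedAction_sharp_of_freeEnergy_le hβ (freeEnergy_le_of_strongCoupling hN hβb) hδ0 hδ1

/-- **THE EQUIPARTITION INEQUALITY ON THE FREE-ENERGY WINDOW, EVERY `N`, UNCONDITIONALLY**: for `β ≥ 0` with `−log Z_N(β) ≤ (N²−1)∕2`,
`β·⟨Re tr(1−V)⟩_β ≤ (N²−1)∕2` — V49's tangent-line Jensen `β⟨s⟩_β ≤ −log Z_N(β)` (V52's named residual holds by itself on the window). [folklore] -/
theorem equipartition_le_of_freeEnergy_le {β : ℝ} (hβ : 0 ≤ β) (hF : -Real.log (∫ V, Real.exp (-(β * (Matrix.trace (1 - (V : Matrix (Fin N) (Fin N) ℂ))).re)) ∂(haarProbability (Matrix.specialUnitaryGroup (Fin N) ℂ))) ≤ ((N ^ 2 - 1 : ℕ) : ℝ) / 2) :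
    β * ((∫ V, (Matrix.trace (1 - (V : Matrix (Fin N) (Fin N) ℂ))).re * Real.exp (-(β * (Matrix.trace (1 - (V : Matrix (Fin N) (Fin N) ℂ))).re)) ∂(haarProbability (Matrix.specialUnitaryGroup (Fin N) ℂ))) / ∫ V, Real.exp (-(β * (Matrix.trace (1 - (V : Matrix (Fin N) (Fin N) ℂ))).re)) ∂(haarProbability (Matrix.specialUnitaryGroup (Fin N) ℂ))) ≤ ((N ^ 2 - 1 : ℕ) : ℝ) / 2 :=
  (mul_meanAction_le_freeEnergy hβ).trans hF

/-- **THE COUPLING RATIO AT FINITE COUPLING ON THE FREE-ENERGY WINDOW**: for `0 ≤ β` with `−log Z_N(β) ≤ (N²−1)∕2` and `0 < ν ≤ 1`, `Z_N(νβ) ≤ (√ν)⁻¹^{N²−1}·Z_N(β)` —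
V49's limit `Z_N(νβ)∕Z_N(β) → ν^{−(N²−1)∕2}` is a one-sided bound at EVERY coupling of the window, every `N` (`ν = 1 − δ` is §2's letter). [folklore] -/
theorem plaquetteMass_ratio_le_of_freeEnergy_le {β ν : ℝ} (hβ : 0 ≤ β) (hF : -Real.log (∫ V, Real.exp (-(β * (Matrix.trace (1 - (V : Matrix (Fin N) (Fin N) ℂ))).re)) ∂(haarProbability (Matrix.specialUnitaryGroup (Fin N) ℂ))) ≤ ((N ^ 2 - 1 : ℕ) : ℝ) / 2) (hν : 0 < ν) (hν1 : ν ≤ 1) :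
    ∫ V, Real.exp (-((ν * β) * (Matrix.trace (1 - (V : Matrix (Fin N) (Fin N) ℂ))).re)) ∂(haarProbability (Matrix.specialUnitaryGroup (Fin N) ℂ))
      ≤ (Real.sqrt ν)⁻¹ ^ (N ^ 2 - 1) * ∫ V, Real.exp (-(β * (Matrix.trace (1 - (V : Matrix (Fin N) (Fin N) ℂ))).re)) ∂(haarProbability (Matrix.specialUnitaryGroup (Fin N) ℂ)) := by
  have h := halvedAction_sharp_of_freeEnergy_le (N := N) (δ := 1 - ν) hβ hF (by linarith) (by linarith)
  rw [halvedAction_eq_plaquetteMass, sub_sub_cancel] at h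
  exact h

/-- The arithmetic of the region letter: `((√(1−δ))⁻¹^d)^{#B} = exp(#B·((d∕2)·log(1−δ)⁻¹))`. -/
theorem sqrt_one_sub_inv_pow_pow_eq (d n : ℕ) {δ : ℝ} (hδ1 : δ < 1) :
    ((Real.sqrt (1 - δ))⁻¹ ^ d) ^ n = Real.exp (n * ((d : ℝ) / 2 * Real.log (1 - δ)⁻¹)) := by
  have h1δ : 0 < 1 - δ := by linarith
  have hsqrt : 0 < Real.sqrt (1 - δ) := Real.sqrt_pos.2 h1δ
  rw [← Real.exp_log (pow_pos (inv_pos.2 hsqrt) d), ← Real.exp_nat_mul, Real.log_pow, Real.log_inv, Real.log_sqrt h1δ.le, Real.log_inv]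
  congr 1
  ring

/-- **THE REGION LETTER WITH NO ADDITIVE CONSTANT ON THE FREE-ENERGY WINDOW, EVERY `N`, UNCONDITIONALLY**: on the product Haar of `B → SU(N)` with `S(v) = Σ_b Re tr(1 − v_b)`, for
`β ≥ 0` with `−log Z_N(β) ≤ (N²−1)∕2` and `0 ≤ δ < 1`: `∫ e^{δβS}·e^{−βS} dκ ≤ exp(#B·((N²−1)∕2)·log(1−δ)⁻¹)·∫ e^{−βS} dκ` — V38's `exists_lcsLetter_compactFibre` with `c = 0`: the
sacrificed fraction `δ` of the region's Wilson action costs EXACTLY print's `½·dim SU(N)·log(1−δ)⁻¹` per plaquette variable there (V38's `pi_halvedAction_moment_le`). [folklore] -/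
theorem lcsLetter_SUN_sharp_of_freeEnergy_le {B : Type*} [Fintype B] {β δ : ℝ} (hβ : 0 ≤ β) (hF : -Real.log (∫ V, Real.exp (-(β * (Matrix.trace (1 - (V : Matrix (Fin N) (Fin N) ℂ))).re)) ∂(haarProbability (Matrix.specialUnitaryGroup (Fin N) ℂ))) ≤ ((N ^ 2 - 1 : ℕ) : ℝ) / 2) (hδ0 : 0 ≤ δ) (hδ1 : δ < 1) :
    ∫ v, Real.exp (δ * β * ∑ b, (Matrix.trace (1 - ((v b : Matrix.specialUnitaryGroup (Fin N) ℂ) : Matrix (Fin N) (Fin N) ℂ))).re)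
        * Real.exp (-(β * ∑ b, (Matrix.trace (1 - ((v b : Matrix.specialUnitaryGroup (Fin N) ℂ) : Matrix (Fin N) (Fin N) ℂ))).re)) ∂(Measure.pi fun _ : B => haarProbability (Matrix.specialUnitaryGroup (Fin N) ℂ))
      ≤ Real.exp (Fintype.card B * (((N ^ 2 - 1 : ℕ) : ℝ) / 2 * Real.log (1 - δ)⁻¹))
        * ∫ v, Real.exp (-(β * ∑ b, (Matrix.trace (1 - ((v b : Matrix.specialUnitaryGroup (Fin N) ℂ) : Matrix (Fin N) (Fin N) ℂ))).re)) ∂(Measure.pi fun _ : B => haarProbability (Matrix.specialUnitaryGroup (Fin N) ℂ)) := by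
  have hpi := pi_halvedAction_moment_le (N := N) (B := B) (halvedAction_sharp_of_freeEnergy_le hβ hF hδ0 hδ1)
  rwa [sqrt_one_sub_inv_pow_pow_eq _ _ hδ1] at hpi

/-- **THE REGION LETTER WITH NO ADDITIVE CONSTANT AT STRONG COUPLING, EVERY `N ≥ 2`, UNCONDITIONALLY**: the same for all `0 ≤ β ≤ (N²−1)∕(2N)`. [folklore] -/
theorem lcsLetter_SUN_sharp_strongCoupling {B : Type*} [Fintype B] (hN : 2 ≤ N) {β δ : ℝ} (hβ : 0 ≤ β) (hβb : β ≤ ((N ^ 2 - 1 : ℕ) : ℝ) / (2 * N))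
    (hδ0 : 0 ≤ δ) (hδ1 : δ < 1) :
    ∫ v, Real.exp (δ * β * ∑ b, (Matrix.trace (1 - ((v b : Matrix.specialUnitaryGroup (Fin N) ℂ) : Matrix (Fin N) (Fin N) ℂ))).re)
        * Real.exp (-(β * ∑ b, (Matrix.trace (1 - ((v b : Matrix.specialUnitaryGroup (Fin N) ℂ) : Matrix (Fin N) (Fin N) ℂ))).re)) ∂(Measure.pi fun _ : B => haarProbability (Matrix.specialUnitaryGroup (Fin N) ℂ))
      ≤ Real.exp (Fintype.card B * (((N ^ 2 - 1 : ℕ) : ℝ) / 2 * Real.log (1 - δ)⁻¹))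
        * ∫ v, Real.exp (-(β * ∑ b, (Matrix.trace (1 - ((v b : Matrix.specialUnitaryGroup (Fin N) ℂ) : Matrix (Fin N) (Fin N) ℂ))).re)) ∂(Measure.pi fun _ : B => haarProbability (Matrix.specialUnitaryGroup (Fin N) ℂ)) :=
  lcsLetter_SUN_sharp_of_freeEnergy_le hβ (freeEnergy_le_of_strongCoupling hN hβb) hδ0 hδ1

/-! ## §3 Every `N`, all couplings: the constant-free letter ⟺ the equipartition inequality; ⟸ the sharp doubling -/

/-- **THE CRITERION, EVERY `N`**: the halved-action letter has NO additive constant at EVERY coupling — `∫ e^{δβs}e^{−βs} ≤ (√(1−δ))⁻¹^{N²−1}·∫ e^{−βs}` for all `β > 0`,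
`0 ≤ δ < 1` — IF AND ONLY IF the equipartition inequality `β·⟨Re tr(1−V)⟩_β ≤ (N²−1)∕2` holds at every `β > 0` (⇒: with `δ = 1 − β₁∕β₂` the letter is the monotonicity of
`(√β)^{N²−1}Z_N(β)`, then V52's criterion; ⇐: V52's criterion and §1). [folklore] -/
theorem halvedAction_sharp_iff_equipartition_le :
    (∀ β δ : ℝ, 0 < β → 0 ≤ δ → δ < 1 →
      ∫ V, Real.exp (δ * β * (Matrix.trace (1 - (V : Matrix (Fin N) (Fin N) ℂ))).re) * Real.exp (-(β * (Matrix.trace (1 - (V : Matrix (Fin N) (Fin N) ℂ))).re)) ∂(haarProbability (Matrix.specialUnitaryGroup (Fin N) ℂ))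
        ≤ (Real.sqrt (1 - δ))⁻¹ ^ (N ^ 2 - 1) * ∫ V, Real.exp (-(β * (Matrix.trace (1 - (V : Matrix (Fin N) (Fin N) ℂ))).re)) ∂(haarProbability (Matrix.specialUnitaryGroup (Fin N) ℂ))) ↔
    ∀ β : ℝ, 0 < β → β * ((∫ V, (Matrix.trace (1 - (V : Matrix (Fin N) (Fin N) ℂ))).re * Real.exp (-(β * (Matrix.trace (1 - (V : Matrix (Fin N) (Fin N) ℂ))).re)) ∂(haarProbability (Matrix.specialUnitaryGroup (Fin N) ℂ))) / ∫ V, Real.exp (-(β * (Matrix.trace (1 - (V : Matrix (Fin N) (Fin N) ℂ))).re)) ∂(haarProbability (Matrix.specialUnitaryGroup (Fin N) ℂ)))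
      ≤ ((N ^ 2 - 1 : ℕ) : ℝ) / 2 := by
  rw [← scaled_plaquetteMass_SUN_monotoneOn_iff_equipartition_le]
  constructor
  · intro h β₁ hβ₁ β₂ _ h12
    have hβ₁' : 0 < β₁ := hβ₁
    have hβ₂ : 0 < β₂ := hβ₁'.trans_le h12
    -- `δ = 1 − β₁∕β₂`, `(1 − δ)·β₂ = β₁`
    have hδ0 : 0 ≤ 1 - β₁ / β₂ := by rw [sub_nonneg, div_le_one hβ₂]; exact h12
    have hδ1 : 1 - β₁ / β₂ < 1 := by linarith [div_pos hβ₁' hβ₂]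
    have hred : (1 - (1 - β₁ / β₂)) * β₂ = β₁ := by field_simp; ring
    have key := h β₂ (1 - β₁ / β₂) hβ₂ hδ0 hδ1
    rw [halvedAction_eq_plaquetteMass, sqrt_one_sub_inv_pow_eq hβ₂ hδ1, hred, div_mul_eq_mul_div,
      le_div_iff₀ (pow_pos (Real.sqrt_pos.2 hβ₁') _), mul_comm] at key
    simpa only using key
  · intro hmono β δ hβ hδ0 hδ1
    have h1δ : 0 < 1 - δ := by linarith
    exact halvedAction_sharp_of_monotoneOn hmono hβ hδ0 hδ1 (show 0 < (1 - δ) * β from mul_pos h1δ hβ) (show 0 < β from hβ)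

/-- **THE SHARP DOUBLING GIVES THE CONSTANT-FREE LETTER AT EVERY COUPLING, EVERY `N`**: if `Haar_{SU(N)}{Re tr(1−V) ≤ λ²t} ≤ λ^{N²−1}·Haar_{SU(N)}{Re tr(1−V) ≤ t}`
(`λ ≥ 1`, all real `t`), then `∫ e^{δβs}e^{−βs} ≤ (√(1−δ))⁻¹^{N²−1}·∫ e^{−βs}` for all `β ≥ 0`, `0 ≤ δ < 1`. [folklore] -/
theorem halvedAction_sharp_of_doubling_one
    (hD : ∀ l : ℝ, 1 ≤ l → ∀ t : ℝ,
      (haarProbability (Matrix.specialUnitaryGroup (Fin N) ℂ)).real {V : Matrix.specialUnitaryGroup (Fin N) ℂ | (Matrix.trace (1 - (V : Matrix (Fin N) (Fin N) ℂ))).re ≤ l ^ 2 * t}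
        ≤ l ^ (N ^ 2 - 1) * (haarProbability (Matrix.specialUnitaryGroup (Fin N) ℂ)).real {V : Matrix.specialUnitaryGroup (Fin N) ℂ | (Matrix.trace (1 - (V : Matrix (Fin N) (Fin N) ℂ))).re ≤ t})
    {β δ : ℝ} (hβ : 0 ≤ β) (hδ0 : 0 ≤ δ) (hδ1 : δ < 1) :
    ∫ V, Real.exp (δ * β * (Matrix.trace (1 - (V : Matrix (Fin N) (Fin N) ℂ))).re) * Real.exp (-(β * (Matrix.trace (1 - (V : Matrix (Fin N) (Fin N) ℂ))).re)) ∂(haarProbability (Matrix.specialUnitaryGroup (Fin N) ℂ))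
      ≤ (Real.sqrt (1 - δ))⁻¹ ^ (N ^ 2 - 1) * ∫ V, Real.exp (-(β * (Matrix.trace (1 - (V : Matrix (Fin N) (Fin N) ℂ))).re)) ∂(haarProbability (Matrix.specialUnitaryGroup (Fin N) ℂ)) := by
  have h1δ : 0 < 1 - δ := by linarith
  rcases hβ.eq_or_lt with hβ0 | hβpos
  · subst hβ0
    have hK1 : (1 : ℝ) ≤ (Real.sqrt (1 - δ))⁻¹ ^ (N ^ 2 - 1) := by
      refine one_le_pow₀ ?_
      rw [one_le_inv₀ (Real.sqrt_pos.2 h1δ)]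
      exact Real.sqrt_le_one.2 (by linarith)
    rw [halvedAction_eq_plaquetteMass, mul_zero]
    exact le_mul_of_one_le_left (plaquetteMass_SUN_pos_real (N := N) 0).le hK1
  · exact halvedAction_sharp_of_monotoneOn (scaled_plaquetteMass_SUN_monotoneOn_of_doubling_one hD) hβpos hδ0 hδ1
      (show 0 < (1 - δ) * β from mul_pos h1δ hβpos) (show 0 < β from hβpos)

/-- **THE REGION LETTER UNDER THE SHARP DOUBLING, EVERY `N`, EVERY COUPLING**: `∫ e^{δβS}e^{−βS} dκ ≤ exp(#B·((N²−1)∕2)·log(1−δ)⁻¹)·∫ e^{−βS} dκ` on the product Haar of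
`B → SU(N)`, for all `β ≥ 0`, `0 ≤ δ < 1` — V38's letter with `c = 0`. [folklore] -/
theorem lcsLetter_SUN_sharp_of_doubling_one {B : Type*} [Fintype B]
    (hD : ∀ l : ℝ, 1 ≤ l → ∀ t : ℝ,
      (haarProbability (Matrix.specialUnitaryGroup (Fin N) ℂ)).real {V : Matrix.specialUnitaryGroup (Fin N) ℂ | (Matrix.trace (1 - (V : Matrix (Fin N) (Fin N) ℂ))).re ≤ l ^ 2 * t}
        ≤ l ^ (N ^ 2 - 1) * (haarProbability (Matrix.specialUnitaryGroup (Fin N) ℂ)).real {V : Matrix.specialUnitaryGroup (Fin N) ℂ | (Matrix.trace (1 - (V : Matrix (Fin N) (Fin N) ℂ))).re ≤ t})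
    {β δ : ℝ} (hβ : 0 ≤ β) (hδ0 : 0 ≤ δ) (hδ1 : δ < 1) :
    ∫ v, Real.exp (δ * β * ∑ b, (Matrix.trace (1 - ((v b : Matrix.specialUnitaryGroup (Fin N) ℂ) : Matrix (Fin N) (Fin N) ℂ))).re)
        * Real.exp (-(β * ∑ b, (Matrix.trace (1 - ((v b : Matrix.specialUnitaryGroup (Fin N) ℂ) : Matrix (Fin N) (Fin N) ℂ))).re)) ∂(Measure.pi fun _ : B => haarProbability (Matrix.specialUnitaryGroup (Fin N) ℂ))
      ≤ Real.exp (Fintype.card B * (((N ^ 2 - 1 : ℕ) : ℝ) / 2 * Real.log (1 - δ)⁻¹))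
        * ∫ v, Real.exp (-(β * ∑ b, (Matrix.trace (1 - ((v b : Matrix.specialUnitaryGroup (Fin N) ℂ) : Matrix (Fin N) (Fin N) ℂ))).re)) ∂(Measure.pi fun _ : B => haarProbability (Matrix.specialUnitaryGroup (Fin N) ℂ)) := by
  have hpi := pi_halvedAction_moment_le (N := N) (B := B) (halvedAction_sharp_of_doubling_one hD hβ hδ0 hδ1)
  rwa [sqrt_one_sub_inv_pow_pow_eq _ _ hδ1] at hpi

/-! ## §4 Sanity: `N = 2` from V40b-Haar (`CompactFibreHalvedActionSU2Sharp`'s statements by this file's route; `example`s, nothing restated) -/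

/-- `N = 2`, one plaquette: `∫ e^{δβs}e^{−βs} ≤ (√(1−δ))⁻¹³·∫ e^{−βs}` for all `β ≥ 0`, `0 ≤ δ < 1` (`halvedAction_moment_le_sharp`). -/
example {β δ : ℝ} (hβ : 0 ≤ β) (hδ0 : 0 ≤ δ) (hδ1 : δ < 1) :
    ∫ V, Real.exp (δ * β * (Matrix.trace (1 - (V : Matrix (Fin 2) (Fin 2) ℂ))).re) * Real.exp (-(β * (Matrix.trace (1 - (V : Matrix (Fin 2) (Fin 2) ℂ))).re)) ∂(haarProbability (Matrix.specialUnitaryGroup (Fin 2) ℂ))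
      ≤ (Real.sqrt (1 - δ))⁻¹ ^ 3 * ∫ V, Real.exp (-(β * (Matrix.trace (1 - (V : Matrix (Fin 2) (Fin 2) ℂ))).re)) ∂(haarProbability (Matrix.specialUnitaryGroup (Fin 2) ℂ)) := by
  have h := halvedAction_sharp_of_doubling_one (N := 2) (fun l hl t => by simpa using haarReal_traceWindow_doubling_one hl t) hβ hδ0 hδ1
  simpa using h

/-- `N = 2`, a region: the letter `#B·(3∕2)·log(1−δ)⁻¹` (`lcsLetter_SU2_sharp`). -/
example {B : Type*} [Fintype B] {β δ : ℝ} (hβ : 0 ≤ β) (hδ0 : 0 ≤ δ) (hδ1 : δ < 1) :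
    ∫ v, Real.exp (δ * β * ∑ b, (Matrix.trace (1 - ((v b : Matrix.specialUnitaryGroup (Fin 2) ℂ) : Matrix (Fin 2) (Fin 2) ℂ))).re)
        * Real.exp (-(β * ∑ b, (Matrix.trace (1 - ((v b : Matrix.specialUnitaryGroup (Fin 2) ℂ) : Matrix (Fin 2) (Fin 2) ℂ))).re)) ∂(Measure.pi fun _ : B => haarProbability (Matrix.specialUnitaryGroup (Fin 2) ℂ))
      ≤ Real.exp (Fintype.card B * ((3 : ℝ) / 2 * Real.log (1 - δ)⁻¹))
        * ∫ v, Real.exp (-(β * ∑ b, (Matrix.trace (1 - ((v b : Matrix.specialUnitaryGroup (Fin 2) ℂ) : Matrix (Fin 2) (Fin 2) ℂ))).re)) ∂(Measure.pi fun _ : B => haarProbability (Matrix.specialUnitaryGroup (Fin 2) ℂ)) := by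
  have h := lcsLetter_SUN_sharp_of_doubling_one (N := 2) (B := B) (fun l hl t => by simpa using haarReal_traceWindow_doubling_one hl t) hβ hδ0 hδ1
  have e : ((2 ^ 2 - 1 : ℕ) : ℝ) / 2 = 3 / 2 := by norm_num
  rw [e] at h
  exact h

end Summit.QuantumFields.BalabanUV.T4Continuum.NE7b.CompactFibreHalvedActionSUNSharp

end
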